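import Mathlib.Topology.Connected.PathConnected
import Mathlib.Topology.Order.IntermediateValue
import Mathlib.Topology.Homeomorph.Lemmas
import Literature.Probability.RandomPlanarGeometry.SimpleCurves
import HarnessLib

/-!
# Route `SAWReversalUpgrade`, support `FaithfulOfNoReturn` (stmt-CriticalPhenomena-18008):
# gluing flat paths, monotone time changes, and simple curves with the same trace

Helper file (6 of several) for the proof of
`Summit.CriticalPhenomena.SAWScalingLimit.Theses.SAWReversalUpgrade.FaithfulOfNoReturn`.
Generic facts about Mathlib's `Path.trans` and the tree's curves modulo reparametrisation
(`Curve`, `Curve.IsFlat`, `Curve.IsSimple`, `Curve.reparamDist`):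

* `isFlat_ofPath_trans` — the concatenation of two flat paths is flat as soon as the only common
  values of the two pieces are the junction value;
* `monotone_trans` — the concatenation of monotone paths of `unitInterval` is monotone;
* `dist_trans_trans_le` — a pointwise distance bound between two concatenations with the same
  breakpoints is inherited from the pieces;
* `reparamDist_eq_zero_of_isSimple` — **two simple curves with the same trace and the same starting
  point are at reparametrisation distance `0`** (the composite `c⁻¹ ∘ m` is a continuous bijection of
  `[0, 1]` fixing `0`, hence an increasing homeomorphism).
-/

noncomputable section

open Set Function
open scoped unitInterval Topology
open Literature.Probability.RandomPlanarGeometry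

namespace Summit.CriticalPhenomena.SAWScalingLimit.Theorems

namespace FaithfulAttach

/-! ### Flat paths and their concatenation -/

section Flat

variable {E : Type*} [TopologicalSpace E] {x y z : E}

/-- An injective path is flat. -/
theorem isFlat_ofPath_of_injective {γ : Path x y} (h : Injective γ) : (Curve.ofPath γ).IsFlat :=
  Curve.IsSimple.isFlat (γ := Curve.ofPath γ) h

/-- A constant path is flat. -/
theorem isFlat_ofPath_of_const {γ : Path x y} (h : ∀ t, γ t = x) : (Curve.ofPath γ).IsFlat := by
  intro s u t _ _ _
  change γ u = γ s
  rw [h, h]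

/-- **Gluing flat paths.** If `γ₁`, `γ₂` are flat and every common value of `γ₁` and `γ₂` is the
junction value `y`, then `γ₁.trans γ₂` is flat. -/
theorem isFlat_ofPath_trans {γ₁ : Path x y} {γ₂ : Path y z} (h₁ : (Curve.ofPath γ₁).IsFlat)
    (h₂ : (Curve.ofPath γ₂).IsFlat) (h12 : ∀ s t : I, γ₁ s = γ₂ t → γ₁ s = y) :
    (Curve.ofPath (γ₁.trans γ₂)).IsFlat := by
  intro s u t hsu hut hst
  change (γ₁.trans γ₂) u = (γ₁.trans γ₂) s
  change (γ₁.trans γ₂) s = (γ₁.trans γ₂) t at hst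
  have hsu' : (s : ℝ) ≤ u := hsu
  have hut' : (u : ℝ) ≤ t := hut
  rw [Path.trans_apply, Path.trans_apply] at hst ⊢
  by_cases ht : (t : ℝ) ≤ 1 / 2
  · -- everything in the first half
    have hu : (u : ℝ) ≤ 1 / 2 := hut'.trans ht
    have hs : (s : ℝ) ≤ 1 / 2 := hsu'.trans hu
    rw [dif_pos hs, dif_pos ht] at hst
    rw [dif_pos hu, dif_pos hs]
    exact h₁ _ _ _ (Subtype.mk_le_mk.2 (by linarith)) (Subtype.mk_le_mk.2 (by linarith)) hst
  · by_cases hs : (s : ℝ) ≤ 1 / 2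
    · -- `s` in the first half, `t` in the second: the common value is `y`
      rw [dif_pos hs, dif_neg ht] at hst
      have hy : γ₁ ⟨2 * s, (unitInterval.mul_pos_mem_iff zero_lt_two).2 ⟨s.2.1, hs⟩⟩ = y := h12 _ _ hst
      -- `γ₁` is constantly `y` on `[2s, 1]`, `γ₂` is constantly `y` on `[0, 2t - 1]`
      by_cases hu : (u : ℝ) ≤ 1 / 2
      · rw [dif_pos hu, dif_pos hs, hy]
        have h1 : γ₁ ⟨2 * s, (unitInterval.mul_pos_mem_iff zero_lt_two).2 ⟨s.2.1, hs⟩⟩ = γ₁ 1 := by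
          rw [hy, γ₁.target]
        have := h₁ ⟨2 * s, (unitInterval.mul_pos_mem_iff zero_lt_two).2 ⟨s.2.1, hs⟩⟩
          ⟨2 * u, (unitInterval.mul_pos_mem_iff zero_lt_two).2 ⟨u.2.1, hu⟩⟩ 1
          (Subtype.mk_le_mk.2 (by linarith)) (Subtype.mk_le_mk.2 (by linarith)) h1
        change γ₁ _ = γ₁ _ at this
        rw [this, hy]
      · rw [dif_neg hu, dif_pos hs, hy]
        have h2 : γ₂ 0 = γ₂ ⟨2 * t - 1, unitInterval.two_mul_sub_one_mem_iff.2 ⟨(not_le.1 ht).le, t.2.2⟩⟩ := by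
          rw [γ₂.source, ← hst, hy]
        have := h₂ 0 ⟨2 * u - 1, unitInterval.two_mul_sub_one_mem_iff.2 ⟨(not_le.1 hu).le, u.2.2⟩⟩
          ⟨2 * t - 1, unitInterval.two_mul_sub_one_mem_iff.2 ⟨(not_le.1 ht).le, t.2.2⟩⟩
          (Subtype.mk_le_mk.2 (by norm_num; linarith [not_le.1 hu]))
          (Subtype.mk_le_mk.2 (by linarith)) h2
        change γ₂ _ = γ₂ _ at this
        rw [this, γ₂.source]
    · -- everything in the second half
      have hu : ¬ (u : ℝ) ≤ 1 / 2 := fun hu => hs (hsu'.trans hu)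
      rw [dif_neg hs, dif_neg ht] at hst
      rw [dif_neg hu, dif_neg hs]
      exact h₂ _ _ _ (Subtype.mk_le_mk.2 (by linarith)) (Subtype.mk_le_mk.2 (by linarith)) hst

end Flat

/-! ### Monotone time changes built with `Path.trans` -/

section MonotoneTime

variable {x y z : I}

/-- The concatenation of two monotone paths of `unitInterval` is monotone. -/
theorem monotone_trans {θ₁ : Path x y} {θ₂ : Path y z} (h₁ : Monotone θ₁) (h₂ : Monotone θ₂) :
    Monotone (θ₁.trans θ₂) := by
  intro s t hst
  have hst' : (s : ℝ) ≤ t := hst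
  rw [Path.trans_apply, Path.trans_apply]
  by_cases hs : (s : ℝ) ≤ 1 / 2
  · by_cases ht : (t : ℝ) ≤ 1 / 2
    · rw [dif_pos hs, dif_pos ht]
      exact h₁ (Subtype.mk_le_mk.2 (by linarith))
    · rw [dif_pos hs, dif_neg ht]
      calc θ₁ ⟨2 * s, (unitInterval.mul_pos_mem_iff zero_lt_two).2 ⟨s.2.1, hs⟩⟩ ≤ θ₁ 1 :=
            h₁ (Subtype.mk_le_mk.2 (by linarith))
        _ = θ₂ 0 := by rw [θ₁.target, θ₂.source]
        _ ≤ _ := h₂ (Subtype.mk_le_mk.2 (by norm_num; linarith [not_le.1 ht]))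
  · have ht : ¬ (t : ℝ) ≤ 1 / 2 := fun ht => hs (hst'.trans ht)
    rw [dif_neg hs, dif_neg ht]
    exact h₂ (Subtype.mk_le_mk.2 (by linarith))

end MonotoneTime

/-! ### Pointwise distance bounds between concatenations -/

section Dist

variable {E F : Type*} [TopologicalSpace E] [PseudoMetricSpace F] {a₁ a₂ a₃ : F} {x y z : E}

/-- If `γₖ` is pointwise `C`-close to `P ∘ θₖ` (`k = 1, 2`), then `γ₁.trans γ₂` is pointwise
`C`-close to `P ∘ (θ₁.trans θ₂)` (same breakpoint `1/2`). -/
theorem dist_trans_trans_le {γ₁ : Path a₁ a₂} {γ₂ : Path a₂ a₃} {θ₁ : Path x y} {θ₂ : Path y z}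
    (P : E → F) {C : ℝ} (h₁ : ∀ t, dist (γ₁ t) (P (θ₁ t)) ≤ C) (h₂ : ∀ t, dist (γ₂ t) (P (θ₂ t)) ≤ C)
    (τ : I) : dist ((γ₁.trans γ₂) τ) (P ((θ₁.trans θ₂) τ)) ≤ C := by
  rw [Path.trans_apply, Path.trans_apply]
  split_ifs with h
  · exact h₁ _
  · exact h₂ _

end Dist

/-! ### Simple curves with the same trace -/

section SameTrace

variable {E : Type*} [MetricSpace E]

/-- **Two simple curves with the same trace and the same starting point are at reparametrisation
distance `0`.** The map `c⁻¹ ∘ m : [0,1] → [0,1]` is a continuous bijection (inverse of a continuous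
bijection of a compact space onto a Hausdorff space) fixing `0`, hence an increasing
self-homeomorphism `φ` with `m = c ∘ φ`. -/
theorem reparamDist_eq_zero_of_isSimple {c m : Curve E} (hc : c.IsSimple) (hm : m.IsSimple)
    (hrange : Set.range c = Set.range m) (h0 : c 0 = m 0) : Curve.reparamDist c m = 0 := by
  -- `c` as a homeomorphism onto its range
  let ec : I ≃ Set.range c := Equiv.ofInjective c hc
  have hec : Continuous ec := c.continuous.subtype_mk _
  let Hc : I ≃ₜ Set.range c := hec.homeoOfEquivCompactToT2 (f := ec)
  have hHc : ∀ t, (Hc t : E) = c t := fun t => rfl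
  -- the time change `g = c⁻¹ ∘ m`
  let g : I → I := fun t => Hc.symm ⟨m t, hrange ▸ Set.mem_range_self t⟩
  have hg : ∀ t, c (g t) = m t := fun t => by
    rw [← hHc]
    change ((Hc (Hc.symm ⟨m t, hrange ▸ Set.mem_range_self t⟩) : Set.range c) : E) = m t
    rw [Hc.apply_symm_apply]
  have hgc : Continuous g := Hc.symm.continuous.comp (m.continuous.subtype_mk _)
  have hgi : Injective g := fun s t hst => hm (by rw [← hg s, ← hg t, hst])
  have hg0 : g 0 = 0 := hc (by rw [hg 0, h0])
  have hmono : StrictMono g := hgc.strictMono_of_inj_boundedOrder (by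
    rw [show (⊥ : I) = 0 from rfl, hg0]; exact (g ⊤).2.1) hgi
  have hsurj : Surjective g := fun s => by
    obtain ⟨t, ht⟩ : c s ∈ Set.range m := hrange ▸ Set.mem_range_self s
    exact ⟨t, hc (by rw [hg t, ht])⟩
  let φ : I ≃o I := hmono.orderIsoOfSurjective g hsurj
  have hφ : ∀ t, φ t = g t := fun t => rfl
  have hm_eq : m = c.reparam φ := by
    ext t
    change m t = c (φ t)
    rw [hφ, hg]
  refine le_antisymm ?_ (Curve.reparamDist_nonneg _ _)
  calc Curve.reparamDist c m ≤ dist c.toContinuousMap (m.reparam φ.symm).toContinuousMap :=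
        Curve.reparamDist_le c m φ.symm
    _ = 0 := by
        rw [hm_eq, Curve.reparam_reparam, OrderIso.symm_trans_self, Curve.reparam_refl, dist_self]

end SameTrace

end FaithfulAttach

end Summit.CriticalPhenomena.SAWScalingLimit.Theorems
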